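import Mathlib
import Summits.KontsevichZagierPeriods.KontsevichZagierPeriods.Theorems.SoloInformedHoffman
import HarnessLib
import HarnessLib.Audit

/-!
# SoloInformed — PROGRAMME LII (Hoffman 1/1): Hoffman's relation at weight 8

Solo programme `solo-KontsevichZagierPeriods-informed`, session s48 (PROGRAMME LII, the weight-8 table of
the formal period ring `𝒫 = KZ.FormalPeriodRing`).

Hoffman's relation (THEOREM L, all depths, proved in `𝒫` by the scale band step) at the admissible
`u` of weight `7`; both index lists of `soloInformed_mzvClass_hoffman_list` evaluate by `rfl`.

References: Hoffman 1992 Thm 5.1, 1997 Thm 4.2; Zagier 1994 §9; Kontsevich–Zagier 2001 §1.2;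
Kaneko–Noro–Tsurumaki 2008 (tables of MZV relations by weight).
-/

noncomputable section

open Literature.NumberTheory.Transcendental
open Literature.NumberTheory.Transcendental.KZ

namespace Summit.KontsevichZagierPeriods.KontsevichZagierPeriods.Theorems

/-- Hoffman's relation for `u = [2, 1, 4]` in `𝒫` (THEOREM L, computable form; lists by `rfl`). -/
theorem soloInformed_w8hof_214 :
    mzvClass [3, 1, 4] + mzvClass [2, 2, 4] + mzvClass [2, 1, 5] =
      mzvClass [2, 1, 4, 1] + mzvClass [2, 1, 3, 2] + mzvClass [2, 1, 2, 3] +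
        mzvClass [2, 1, 1, 4] := by
  have hl : soloInformedHofLHS [2, 1, 4] =
      [[3, 1, 4], [2, 2, 4], [2, 1, 5]] := rfl
  have hr : soloInformedHofRHS [2, 1, 4] =
      [[2, 1, 1, 4], [2, 1, 2, 3], [2, 1, 3, 2], [2, 1, 4, 1]] := rfl
  have h := soloInformed_mzvClass_hoffman_list (u := [2, 1, 4]) (by decide) (by simp)
  rw [hl, hr] at h
  simp only [List.map_cons, List.map_nil, List.sum_cons, List.sum_nil, add_zero] at h
  linear_combination h

/-- Hoffman's relation for `u = [2, 2, 3]` in `𝒫` (THEOREM L, computable form; lists by `rfl`). -/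
theorem soloInformed_w8hof_223 :
    mzvClass [3, 2, 3] + mzvClass [2, 3, 3] + mzvClass [2, 2, 4] =
      mzvClass [2, 2, 3, 1] + mzvClass [2, 2, 2, 2] + mzvClass [2, 2, 1, 3] +
        mzvClass [2, 1, 2, 3] := by
  have hl : soloInformedHofLHS [2, 2, 3] =
      [[3, 2, 3], [2, 3, 3], [2, 2, 4]] := rfl
  have hr : soloInformedHofRHS [2, 2, 3] =
      [[2, 1, 2, 3], [2, 2, 1, 3], [2, 2, 2, 2], [2, 2, 3, 1]] := rfl
  have h := soloInformed_mzvClass_hoffman_list (u := [2, 2, 3]) (by decide) (by simp)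
  rw [hl, hr] at h
  simp only [List.map_cons, List.map_nil, List.sum_cons, List.sum_nil, add_zero] at h
  linear_combination h

/-- Hoffman's relation for `u = [2, 3, 2]` in `𝒫` (THEOREM L, computable form; lists by `rfl`). -/
theorem soloInformed_w8hof_232 :
    mzvClass [3, 3, 2] + mzvClass [2, 4, 2] + mzvClass [2, 3, 3] =
      mzvClass [2, 3, 2, 1] + mzvClass [2, 3, 1, 2] + mzvClass [2, 2, 2, 2] +
        mzvClass [2, 1, 3, 2] := by
  have hl : soloInformedHofLHS [2, 3, 2] =
      [[3, 3, 2], [2, 4, 2], [2, 3, 3]] := rfl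
  have hr : soloInformedHofRHS [2, 3, 2] =
      [[2, 1, 3, 2], [2, 2, 2, 2], [2, 3, 1, 2], [2, 3, 2, 1]] := rfl
  have h := soloInformed_mzvClass_hoffman_list (u := [2, 3, 2]) (by decide) (by simp)
  rw [hl, hr] at h
  simp only [List.map_cons, List.map_nil, List.sum_cons, List.sum_nil, add_zero] at h
  linear_combination h

/-- Hoffman's relation for `u = [2, 5]` in `𝒫` (THEOREM L, computable form; lists by `rfl`). -/
theorem soloInformed_w8hof_25 :
    mzvClass [3, 5] + mzvClass [2, 6] =
      mzvClass [2, 5, 1] + mzvClass [2, 4, 2] + mzvClass [2, 3, 3] + mzvClass [2, 2, 4] +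
        mzvClass [2, 1, 5] := by
  have hl : soloInformedHofLHS [2, 5] =
      [[3, 5], [2, 6]] := rfl
  have hr : soloInformedHofRHS [2, 5] =
      [[2, 1, 5], [2, 2, 4], [2, 3, 3], [2, 4, 2], [2, 5, 1]] := rfl
  have h := soloInformed_mzvClass_hoffman_list (u := [2, 5]) (by decide) (by simp)
  rw [hl, hr] at h
  simp only [List.map_cons, List.map_nil, List.sum_cons, List.sum_nil, add_zero] at h
  linear_combination h

/-- Hoffman's relation for `u = [3, 1, 1, 2]` in `𝒫` (THEOREM L, computable form; lists by `rfl`). -/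
theorem soloInformed_w8hof_3112 :
    mzvClass [4, 1, 1, 2] + mzvClass [3, 2, 1, 2] + mzvClass [3, 1, 2, 2] + mzvClass [3, 1, 1, 3] =
      mzvClass [3, 1, 1, 2, 1] + mzvClass [3, 1, 1, 1, 2] + mzvClass [2, 2, 1, 1, 2] := by
  have hl : soloInformedHofLHS [3, 1, 1, 2] =
      [[4, 1, 1, 2], [3, 2, 1, 2], [3, 1, 2, 2], [3, 1, 1, 3]] := rfl
  have hr : soloInformedHofRHS [3, 1, 1, 2] =
      [[2, 2, 1, 1, 2], [3, 1, 1, 1, 2], [3, 1, 1, 2, 1]] := rfl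
  have h := soloInformed_mzvClass_hoffman_list (u := [3, 1, 1, 2]) (by decide) (by simp)
  rw [hl, hr] at h
  simp only [List.map_cons, List.map_nil, List.sum_cons, List.sum_nil, add_zero] at h
  linear_combination h

/-- Hoffman's relation for `u = [3, 1, 3]` in `𝒫` (THEOREM L, computable form; lists by `rfl`). -/
theorem soloInformed_w8hof_313 :
    mzvClass [4, 1, 3] + mzvClass [3, 2, 3] + mzvClass [3, 1, 4] =
      mzvClass [3, 1, 3, 1] + mzvClass [3, 1, 2, 2] + mzvClass [3, 1, 1, 3] +
        mzvClass [2, 2, 1, 3] := by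
  have hl : soloInformedHofLHS [3, 1, 3] =
      [[4, 1, 3], [3, 2, 3], [3, 1, 4]] := rfl
  have hr : soloInformedHofRHS [3, 1, 3] =
      [[2, 2, 1, 3], [3, 1, 1, 3], [3, 1, 2, 2], [3, 1, 3, 1]] := rfl
  have h := soloInformed_mzvClass_hoffman_list (u := [3, 1, 3]) (by decide) (by simp)
  rw [hl, hr] at h
  simp only [List.map_cons, List.map_nil, List.sum_cons, List.sum_nil, add_zero] at h
  linear_combination h

/-- Hoffman's relation for `u = [3, 2, 2]` in `𝒫` (THEOREM L, computable form; lists by `rfl`). -/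
theorem soloInformed_w8hof_322 :
    mzvClass [4, 2, 2] + mzvClass [3, 3, 2] + mzvClass [3, 2, 3] =
      mzvClass [3, 2, 2, 1] + mzvClass [3, 2, 1, 2] + mzvClass [3, 1, 2, 2] +
        mzvClass [2, 2, 2, 2] := by
  have hl : soloInformedHofLHS [3, 2, 2] =
      [[4, 2, 2], [3, 3, 2], [3, 2, 3]] := rfl
  have hr : soloInformedHofRHS [3, 2, 2] =
      [[2, 2, 2, 2], [3, 1, 2, 2], [3, 2, 1, 2], [3, 2, 2, 1]] := rfl
  have h := soloInformed_mzvClass_hoffman_list (u := [3, 2, 2]) (by decide) (by simp)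
  rw [hl, hr] at h
  simp only [List.map_cons, List.map_nil, List.sum_cons, List.sum_nil, add_zero] at h
  linear_combination h

/-- Hoffman's relation for `u = [3, 3, 1]` in `𝒫` (THEOREM L, computable form; lists by `rfl`). -/
theorem soloInformed_w8hof_331 :
    mzvClass [4, 3, 1] + mzvClass [3, 4, 1] + mzvClass [3, 3, 2] =
      mzvClass [3, 3, 1, 1] + mzvClass [3, 2, 2, 1] + mzvClass [3, 1, 3, 1] +
        mzvClass [2, 2, 3, 1] := by
  have hl : soloInformedHofLHS [3, 3, 1] =
      [[4, 3, 1], [3, 4, 1], [3, 3, 2]] := rfl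
  have hr : soloInformedHofRHS [3, 3, 1] =
      [[2, 2, 3, 1], [3, 1, 3, 1], [3, 2, 2, 1], [3, 3, 1, 1]] := rfl
  have h := soloInformed_mzvClass_hoffman_list (u := [3, 3, 1]) (by decide) (by simp)
  rw [hl, hr] at h
  simp only [List.map_cons, List.map_nil, List.sum_cons, List.sum_nil, add_zero] at h
  linear_combination h

/-- Hoffman's relation for `u = [3, 4]` in `𝒫` (THEOREM L, computable form; lists by `rfl`). -/
theorem soloInformed_w8hof_34 :
    mzvClass [4, 4] + mzvClass [3, 5] =
      mzvClass [3, 4, 1] + mzvClass [3, 3, 2] + mzvClass [3, 2, 3] + mzvClass [3, 1, 4] +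
        mzvClass [2, 2, 4] := by
  have hl : soloInformedHofLHS [3, 4] =
      [[4, 4], [3, 5]] := rfl
  have hr : soloInformedHofRHS [3, 4] =
      [[2, 2, 4], [3, 1, 4], [3, 2, 3], [3, 3, 2], [3, 4, 1]] := rfl
  have h := soloInformed_mzvClass_hoffman_list (u := [3, 4]) (by decide) (by simp)
  rw [hl, hr] at h
  simp only [List.map_cons, List.map_nil, List.sum_cons, List.sum_nil, add_zero] at h
  linear_combination h

/-- Hoffman's relation for `u = [4, 1, 2]` in `𝒫` (THEOREM L, computable form; lists by `rfl`). -/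
theorem soloInformed_w8hof_412 :
    mzvClass [5, 1, 2] + mzvClass [4, 2, 2] + mzvClass [4, 1, 3] =
      mzvClass [4, 1, 2, 1] + mzvClass [4, 1, 1, 2] + mzvClass [3, 2, 1, 2] +
        mzvClass [2, 3, 1, 2] := by
  have hl : soloInformedHofLHS [4, 1, 2] =
      [[5, 1, 2], [4, 2, 2], [4, 1, 3]] := rfl
  have hr : soloInformedHofRHS [4, 1, 2] =
      [[2, 3, 1, 2], [3, 2, 1, 2], [4, 1, 1, 2], [4, 1, 2, 1]] := rfl
  have h := soloInformed_mzvClass_hoffman_list (u := [4, 1, 2]) (by decide) (by simp)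
  rw [hl, hr] at h
  simp only [List.map_cons, List.map_nil, List.sum_cons, List.sum_nil, add_zero] at h
  linear_combination h

/-- Hoffman's relation for `u = [4, 2, 1]` in `𝒫` (THEOREM L, computable form; lists by `rfl`). -/
theorem soloInformed_w8hof_421 :
    mzvClass [5, 2, 1] + mzvClass [4, 3, 1] + mzvClass [4, 2, 2] =
      mzvClass [4, 2, 1, 1] + mzvClass [4, 1, 2, 1] + mzvClass [3, 2, 2, 1] +
        mzvClass [2, 3, 2, 1] := by
  have hl : soloInformedHofLHS [4, 2, 1] =
      [[5, 2, 1], [4, 3, 1], [4, 2, 2]] := rfl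
  have hr : soloInformedHofRHS [4, 2, 1] =
      [[2, 3, 2, 1], [3, 2, 2, 1], [4, 1, 2, 1], [4, 2, 1, 1]] := rfl
  have h := soloInformed_mzvClass_hoffman_list (u := [4, 2, 1]) (by decide) (by simp)
  rw [hl, hr] at h
  simp only [List.map_cons, List.map_nil, List.sum_cons, List.sum_nil, add_zero] at h
  linear_combination h

/-- Hoffman's relation for `u = [4, 3]` in `𝒫` (THEOREM L, computable form; lists by `rfl`). -/
theorem soloInformed_w8hof_43 :
    mzvClass [5, 3] + mzvClass [4, 4] =
      mzvClass [4, 3, 1] + mzvClass [4, 2, 2] + mzvClass [4, 1, 3] + mzvClass [3, 2, 3] +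
        mzvClass [2, 3, 3] := by
  have hl : soloInformedHofLHS [4, 3] =
      [[5, 3], [4, 4]] := rfl
  have hr : soloInformedHofRHS [4, 3] =
      [[2, 3, 3], [3, 2, 3], [4, 1, 3], [4, 2, 2], [4, 3, 1]] := rfl
  have h := soloInformed_mzvClass_hoffman_list (u := [4, 3]) (by decide) (by simp)
  rw [hl, hr] at h
  simp only [List.map_cons, List.map_nil, List.sum_cons, List.sum_nil, add_zero] at h
  linear_combination h

/-- Hoffman's relation for `u = [5, 1, 1]` in `𝒫` (THEOREM L, computable form; lists by `rfl`). -/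
theorem soloInformed_w8hof_511 :
    mzvClass [6, 1, 1] + mzvClass [5, 2, 1] + mzvClass [5, 1, 2] =
      mzvClass [5, 1, 1, 1] + mzvClass [4, 2, 1, 1] + mzvClass [3, 3, 1, 1] +
        mzvClass [2, 4, 1, 1] := by
  have hl : soloInformedHofLHS [5, 1, 1] =
      [[6, 1, 1], [5, 2, 1], [5, 1, 2]] := rfl
  have hr : soloInformedHofRHS [5, 1, 1] =
      [[2, 4, 1, 1], [3, 3, 1, 1], [4, 2, 1, 1], [5, 1, 1, 1]] := rfl
  have h := soloInformed_mzvClass_hoffman_list (u := [5, 1, 1]) (by decide) (by simp)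
  rw [hl, hr] at h
  simp only [List.map_cons, List.map_nil, List.sum_cons, List.sum_nil, add_zero] at h
  linear_combination h

/-- Hoffman's relation for `u = [5, 2]` in `𝒫` (THEOREM L, computable form; lists by `rfl`). -/
theorem soloInformed_w8hof_52 :
    mzvClass [6, 2] + mzvClass [5, 3] =
      mzvClass [5, 2, 1] + mzvClass [5, 1, 2] + mzvClass [4, 2, 2] + mzvClass [3, 3, 2] +
        mzvClass [2, 4, 2] := by
  have hl : soloInformedHofLHS [5, 2] =
      [[6, 2], [5, 3]] := rfl
  have hr : soloInformedHofRHS [5, 2] =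
      [[2, 4, 2], [3, 3, 2], [4, 2, 2], [5, 1, 2], [5, 2, 1]] := rfl
  have h := soloInformed_mzvClass_hoffman_list (u := [5, 2]) (by decide) (by simp)
  rw [hl, hr] at h
  simp only [List.map_cons, List.map_nil, List.sum_cons, List.sum_nil, add_zero] at h
  linear_combination h

/-- Hoffman's relation for `u = [6, 1]` in `𝒫` (THEOREM L, computable form; lists by `rfl`). -/
theorem soloInformed_w8hof_61 :
    mzvClass [7, 1] + mzvClass [6, 2] =
      mzvClass [6, 1, 1] + mzvClass [5, 2, 1] + mzvClass [4, 3, 1] + mzvClass [3, 4, 1] +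
        mzvClass [2, 5, 1] := by
  have hl : soloInformedHofLHS [6, 1] =
      [[7, 1], [6, 2]] := rfl
  have hr : soloInformedHofRHS [6, 1] =
      [[2, 5, 1], [3, 4, 1], [4, 3, 1], [5, 2, 1], [6, 1, 1]] := rfl
  have h := soloInformed_mzvClass_hoffman_list (u := [6, 1]) (by decide) (by simp)
  rw [hl, hr] at h
  simp only [List.map_cons, List.map_nil, List.sum_cons, List.sum_nil, add_zero] at h
  linear_combination h

/-- Hoffman's relation for `u = [7]` in `𝒫` (THEOREM L, computable form; lists by `rfl`). -/
theorem soloInformed_w8hof_7 :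
    mzvClass [8] =
      mzvClass [7, 1] + mzvClass [6, 2] + mzvClass [5, 3] + mzvClass [4, 4] + mzvClass [3, 5] +
        mzvClass [2, 6] := by
  have hl : soloInformedHofLHS [7] =
      [[8]] := rfl
  have hr : soloInformedHofRHS [7] =
      [[2, 6], [3, 5], [4, 4], [5, 3], [6, 2], [7, 1]] := rfl
  have h := soloInformed_mzvClass_hoffman_list (u := [7]) (by decide) (by simp)
  rw [hl, hr] at h
  simp only [List.map_cons, List.map_nil, List.sum_cons, List.sum_nil, add_zero] at h
  linear_combination h


end Summit.KontsevichZagierPeriods.KontsevichZagierPeriods.Theorems
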